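import Summits.BirchSwinnertonDyer.BirchSwinnertonDyer.Theorems.AlignedTransportAtTwoMainConjectureTransportAlignedAtTwoAddTwistCusp
import HarnessLib

/-!
# Route `AlignedTransportAtTwo`, crux C1 `MainConjectureTransportAlignedAtTwo` (stmt-BirchSwinnertonDyer-22296), line `birth` —
# the BOTH-ADDITIVE twist sub-cell, part 1b (HALF SUMS): `U_ℓ`-vanishing at a prime with `a_ℓ = 0` and the `2`-adic
# half-integrality of the half-character sums `Σ_{χ(b)=±1} [b/ℓ]⁺` from ONE odd Eisenstein multiple

HONEST FRAMING (cell `bsd-f1-sign2`, WIDTH-5 attach seat `bsd-line-att-p4` g9, under the lead `bsd-line-att-p1`). BSD is NOT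
proved; C1 is NOT closed. THEOREMS ONLY; nothing asserted; `--supports stmt-BirchSwinnertonDyer-22296 --as helper`. Sequel of
`…AddTwistCusp` (§1–§3: cusp classes over `ℓ` when `ℓ² ∣ N`, `T_q` at the cusps `u/ℓ`).

* `sum_ratPlusSymbol_div_eq_zero` — **`U_ℓ`-vanishing**: `a_ℓ(f) = 0` (`ℓ² ∣ N`, e.g. an ADDITIVE prime of the curve) gives
  `Σ_{b mod ℓ} [b/ℓ]⁺_f = 0` EXACTLY (`U_ℓ f = a_ℓ f`), so over the units the sum is `−[0]⁺` and
  `Σ_{χ(b)=1} [b/ℓ]⁺ + Σ_{χ(b)=−1} [b/ℓ]⁺ = −[0]⁺` (`sum_filter_one_add_sum_filter_neg_one_eq`) — at a both-additive prime the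
  depletion factor is `−1`, there is NO Euler factor / local `λ`-term.
* `exists_intCast_mul_sum_filter_eq` — `T_q` on the character sums: `a_q·H^ε = (q+1)·H^{χ(q)ε} + j/2`.
* `exists_sum_filter_ratPlusSymbol_div_eq_div_two_mul` — **THE HALF-CHARACTER SUMS ARE `2`-ADICALLY HALF-INTEGRAL**: for a
  character `χ` mod `ℓ` with values in `ℤ` and ONE odd prime `q ∤ N` with `a_q − q − 1` ODD (it exists when `E[2]` is
  irreducible: `not_irreducible_of_frobeniusTrace_congr_holds`, as in INT2 `PAdicLFunctionIntegralityAtTwoProofs`),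
  `H^ε = Σ_{χ(b)=ε} [b/ℓ]⁺ = j/(2n₁)` with `n₁` ODD (`χ(q) = 1`: divide `(a_q − q − 1)H^ε ∈ ½ℤ`; `χ(q) = −1`:
  `(a_q + q + 1)H^ε = −(q+1)[0]⁺ + j/2` with `[0]⁺ = k₀/(2(a_q − q − 1))`); hence `‖H^ε‖₂ ≤ 2`
  (`norm_ratCast_le_two_of_eq_div_two_mul`).
Part 2 (`…AddTwistTame`) turns this into `‖Σ_{χ(b)=−1} μ_{f,α,ℓ}(· × {b})‖₂ ≤ 2` and the congruence
`L₂(f,α,χ_ℓ) ≡ L₂(f,α,𝟙_ℓ) = −(1+T)^{c}·L₂(f,α) (mod 2Λ)` — the analytic Kida step at `2` with ZERO local terms at a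
both-additive prime (the class-`1/g` Manin trick of `…TameIntegralityAtTwoSharedPrimesProofs` needs `gcd(g, N/g) = 1`).

References: [MazurTateTeitelbaum1986Invent] §I.4 (4.2), §I.8, §I.10; [CremonaAlgorithms1997] §2.2, §2.8 (2.8.8); [Matsuno2000]
Lemma 3.2 (p. 87); [GreenbergVatsal2000] Prop. (3.7); [DarmonDiamondTaylor1995] Prop. 2.6(b).
-/

set_option autoImplicit false
set_option linter.dupNamespace false

noncomputable section

open scoped Classical MatrixGroups ModularForm

open CongruenceSubgroup Literature.NumberTheory.EllipticCurves Literature.NumberTheory.EllipticCurves.ModularForms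
open Summit.BirchSwinnertonDyer.BirchSwinnertonDyer.Theorems.AlignedTransportAtTwoAddTwistCusp

namespace Summit.BirchSwinnertonDyer.BirchSwinnertonDyer.Theorems.AlignedTransportAtTwoAddTwistHalfSums

/-! ## §4 `U_ℓ`-vanishing and the half-character sums `Σ_{χ(b) = ε} [b/ℓ]⁺` -/

section HalfSums

variable {N : ℕ} [NeZero N] (f : CuspForm (Gamma0 N) 2) {ℓ : ℕ} [Fact ℓ.Prime]

omit [NeZero N] [Fact ℓ.Prime] in
/-- Reindexing `Fin ℓ → ZMod ℓ` along `ZMod.finEquiv`; private helper. [folklore] -/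
private theorem sum_fin_eq_sum_zmod_val [NeZero ℓ] {M : Type*} [AddCommMonoid M] (g : ℕ → M) :
    ∑ j : Fin ℓ, g j = ∑ d : ZMod ℓ, g d.val := by
  refine Fintype.sum_equiv (ZMod.finEquiv ℓ).toEquiv _ _ fun j ↦ ?_
  obtain ⟨p', rfl⟩ : ∃ p', ℓ = p' + 1 := Nat.exists_eq_succ_of_ne_zero (NeZero.ne ℓ)
  rfl

/-- **`U_ℓ`-vanishing: `Σ_{b mod ℓ} [b/ℓ]⁺_f = 0` when `a_ℓ(f) = 0`** (`ℓ ∣ N`; the `U_ℓ`-relation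
`a_ℓ[r]⁺ = Σ_j [(r + j)/ℓ]⁺`, `intCast_mul_ratPlusSymbol_of_dvd`, at `r = 0`). At an ADDITIVE prime of a curve this is the tree's
`sum_ratPlusSymbol_add_div_eq_zero_of_addv` at `s = 0`. [cite: MazurTateTeitelbaum1986Invent, §I.4 (4.2)] -/
theorem sum_ratPlusSymbol_div_eq_zero (hf : IsNewform0 f)
    (hrat : ∀ r : ℚ, (ratPlusSymbol f r : ℝ) = normalizedPlusSymbol f r) (hℓN : ℓ ∣ N) (haℓ : cuspCoeff f ℓ = 0) :
    ∑ b : ZMod ℓ, ratPlusSymbol f ((b.val : ℚ) / ℓ) = 0 := by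
  have hℓ : ℓ.Prime := Fact.out
  have h := intCast_mul_ratPlusSymbol_of_dvd ℓ hf hℓ hℓN (ap := 0) (by rw [haℓ, Int.cast_zero]) hrat 0
  rw [Int.cast_zero, zero_mul] at h
  simp_rw [zero_add] at h
  rw [sum_fin_eq_sum_zmod_val (fun k : ℕ ↦ ratPlusSymbol f ((k : ℚ) / ℓ))] at h
  exact h.symm

/-- A multiplicative character `χ` mod `ℓ` with values in `ℤ` takes the values `±1` on the units. [folklore] -/
theorem mulChar_apply_eq_one_or_eq_neg_one (χ : MulChar (ZMod ℓ) ℤ) {b : ZMod ℓ} (hb : b ≠ 0) :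
    χ b = 1 ∨ χ b = -1 := by
  have hu : IsUnit b := isUnit_iff_ne_zero.mpr hb
  obtain ⟨u, rfl⟩ := hu
  have h : IsUnit (χ (u : ZMod ℓ)) := by
    rw [← MulChar.coe_toUnitHom]
    exact Units.isUnit _
  exact Int.isUnit_iff.mp h

/-- **`Σ_{χ(b)=1} [b/ℓ]⁺ + Σ_{χ(b)=−1} [b/ℓ]⁺ = −[0]⁺`** when `a_ℓ(f) = 0`: the units of `ℤ/ℓ` split into `{χ = 1}` and `{χ = −1}`,
and the full sum vanishes (`sum_ratPlusSymbol_div_eq_zero`), the class `b = 0` contributing `[0]⁺`.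
[cite: MazurTateTeitelbaum1986Invent, §I.4 (4.2)] -/
theorem sum_filter_one_add_sum_filter_neg_one_eq (hf : IsNewform0 f)
    (hrat : ∀ r : ℚ, (ratPlusSymbol f r : ℝ) = normalizedPlusSymbol f r) (hℓN : ℓ ∣ N) (haℓ : cuspCoeff f ℓ = 0)
    (χ : MulChar (ZMod ℓ) ℤ) :
    ∑ b ∈ Finset.univ.filter (fun b : ZMod ℓ ↦ χ b = 1), ratPlusSymbol f ((b.val : ℚ) / ℓ) +
      ∑ b ∈ Finset.univ.filter (fun b : ZMod ℓ ↦ χ b = -1), ratPlusSymbol f ((b.val : ℚ) / ℓ) =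
        -ratPlusSymbol f 0 := by
  have htot := sum_ratPlusSymbol_div_eq_zero f hf hrat hℓN haℓ
  set g : ZMod ℓ → ℚ := fun b ↦ ratPlusSymbol f ((b.val : ℚ) / ℓ) with hg
  have hχ0 : χ 0 = 0 := χ.map_nonunit not_isUnit_zero
  have hsplit : ∀ b : ZMod ℓ, g b =
      (if b = 0 then g b else 0) + ((if χ b = 1 then g b else 0) + (if χ b = -1 then g b else 0)) := by
    intro b
    by_cases hb : b = 0
    · rw [if_pos hb, hb, hχ0]; simp
    · rw [if_neg hb]
      rcases mulChar_apply_eq_one_or_eq_neg_one χ hb with h | h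
      · rw [if_pos h, if_neg (by rw [h]; norm_num)]; ring
      · rw [if_neg (by rw [h]; norm_num), if_pos h]; ring
  have hsum : ∑ b : ZMod ℓ, g b = g 0 +
      (∑ b ∈ Finset.univ.filter (fun b : ZMod ℓ ↦ χ b = 1), g b +
        ∑ b ∈ Finset.univ.filter (fun b : ZMod ℓ ↦ χ b = -1), g b) := by
    rw [Finset.sum_congr rfl fun b _ ↦ hsplit b, Finset.sum_add_distrib, Finset.sum_add_distrib,
      Finset.sum_ite_eq' Finset.univ (0 : ZMod ℓ) g, if_pos (Finset.mem_univ _), Finset.sum_filter, Finset.sum_filter]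
  have hg0 : g 0 = ratPlusSymbol f 0 := by simp [hg]
  rw [htot, hg0] at hsum
  linear_combination -hsum

/-- **`T_q` on the character sums**: for `q ∤ N` prime and `χ` mod `ℓ` (`ℓ² ∣ N`, `a` arbitrary), with `δ = χ(q)`:
`a_q · Σ_{χ(b)=ε} [b/ℓ]⁺ = (q + 1) · Σ_{χ(b)=δε} [b/ℓ]⁺ + j/2` — sum §3 over `{χ = ε}`: `b ↦ qb` and `b ↦ q⁻¹b` map `{χ = ε}`
onto `{χ = δε}` (`χ(q⁻¹) = χ(q) = δ = ±1`). [cite: MazurTateTeitelbaum1986Invent, §I.4 (4.2)]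
[cite: CremonaAlgorithms1997, §2.2 Lemma 2.2.3 and §2.8 (2.8.8)] -/
theorem exists_intCast_mul_sum_filter_eq (hf : IsNewform0 f) (hreal : ∀ n, (cuspCoeff f n).im = 0)
    (hrat : ∀ r : ℚ, (ratPlusSymbol f r : ℝ) = normalizedPlusSymbol f r)
    (hℓN : ℓ ^ 2 ∣ N) {q : ℕ} [Fact q.Prime] (hqN : ¬ q ∣ N) {aq : ℤ} (haq : cuspCoeff f q = aq)
    (χ : MulChar (ZMod ℓ) ℤ) (ε : ℤ) :
    ∃ j : ℤ, (aq : ℚ) * ∑ b ∈ Finset.univ.filter (fun b : ZMod ℓ ↦ χ b = ε), ratPlusSymbol f ((b.val : ℚ) / ℓ) =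
      ((q : ℚ) + 1) * ∑ b ∈ Finset.univ.filter (fun b : ZMod ℓ ↦ χ b = χ q * ε), ratPlusSymbol f ((b.val : ℚ) / ℓ) +
        (j : ℚ) / 2 := by
  have hq : q.Prime := Fact.out
  have hℓ : ℓ.Prime := Fact.out
  have hqℓ : ¬ q ∣ ℓ := fun h ↦ hqN (h.trans ((dvd_pow_self ℓ two_ne_zero).trans hℓN))
  have hqu : (q : ZMod ℓ) ≠ 0 := by
    rw [Ne, ZMod.natCast_eq_zero_iff]
    intro h
    exact hqℓ (by rw [(Nat.prime_dvd_prime_iff_eq hℓ hq).mp h])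
  set g : ZMod ℓ → ℚ := fun b ↦ ratPlusSymbol f ((b.val : ℚ) / ℓ) with hg
  set δ : ℤ := χ q with hδ
  have hδu : δ = 1 ∨ δ = -1 := mulChar_apply_eq_one_or_eq_neg_one χ hqu
  have hδsq : δ * δ = 1 := by rcases hδu with h | h <;> rw [h] <;> norm_num
  have hχinv : χ ((q : ZMod ℓ)⁻¹) = δ := by
    have h1 : χ ((q : ZMod ℓ)⁻¹) * δ = 1 := by
      rw [hδ, ← map_mul, inv_mul_cancel₀ hqu, map_one]
    rcases hδu with h | h <;> rw [h] at h1 ⊢ <;> linarith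
  -- termwise §3 with `u = b.val`, `u' = (q⁻¹ b).val`
  have hterm : ∀ b ∈ Finset.univ.filter (fun b : ZMod ℓ ↦ χ b = ε), ∃ i : ℤ,
      (aq : ℚ) * g b = ((q : ℚ) * g (q * b) + g ((q : ZMod ℓ)⁻¹ * b)) + (i : ℚ) / 2 := by
    intro b _
    have hu' : ((q : ℤ) * (((q : ZMod ℓ)⁻¹ * b).val : ℤ) : ZMod ℓ) = ((b.val : ℤ) : ZMod ℓ) := by
      push_cast
      rw [ZMod.natCast_zmod_val, ZMod.natCast_zmod_val, mul_inv_cancel_left₀ hqu]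
    obtain ⟨i, hi⟩ := exists_intCast_mul_ratPlusSymbol_div_eq f hf hreal hrat hℓN hqN haq (b.val : ℤ)
      (((q : ZMod ℓ)⁻¹ * b).val : ℤ) hu'
    refine ⟨i, ?_⟩
    have h1 : ratPlusSymbol f (((q : ℤ) : ℚ) * ((b.val : ℤ) : ℚ) / ℓ) = g (q * b) := by
      have hcl : (((q : ℤ) * (b.val : ℤ) : ℤ) : ZMod ℓ) = ((((q : ZMod ℓ) * b).val : ℤ) : ZMod ℓ) := by
        push_cast
        rw [ZMod.natCast_zmod_val, ZMod.natCast_zmod_val]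
      have h := ratPlusSymbol_div_eq_of_intCast_eq f hℓ.ne_zero hcl
      simp only [hg]
      push_cast at h ⊢
      exact h
    have h2 : ratPlusSymbol f (((((q : ZMod ℓ)⁻¹ * b).val : ℤ) : ℚ) / ℓ) = g ((q : ZMod ℓ)⁻¹ * b) := by
      simp only [hg]; push_cast; rfl
    have h0 : ratPlusSymbol f (((b.val : ℤ) : ℚ) / ℓ) = g b := by simp only [hg]; push_cast; rfl
    rw [← h0, hi, h1, h2]
  obtain ⟨i, hi⟩ := exists_sum_eq_sum_add_div_two (Finset.univ.filter (fun b : ZMod ℓ ↦ χ b = ε)) hterm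
  -- reindex the two sums onto `{χ = δ ε}`
  have hS1 : ∑ b ∈ Finset.univ.filter (fun b : ZMod ℓ ↦ χ b = ε), g (q * b) =
      ∑ b ∈ Finset.univ.filter (fun b : ZMod ℓ ↦ χ b = χ q * ε), g b := by
    refine Finset.sum_nbij' (fun b ↦ (q : ZMod ℓ) * b) (fun b ↦ (q : ZMod ℓ)⁻¹ * b) ?_ ?_ ?_ ?_ ?_
    · intro b hb
      simp only [Finset.mem_filter, Finset.mem_univ, true_and] at hb ⊢
      rw [map_mul, hb]
    · intro b hb
      simp only [Finset.mem_filter, Finset.mem_univ, true_and] at hb ⊢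
      rw [map_mul, hχinv, hb, ← hδ, ← mul_assoc, hδsq, one_mul]
    · intro b _; simp only [inv_mul_cancel_left₀ hqu]
    · intro b _; simp only [mul_inv_cancel_left₀ hqu]
    · intro b _; rfl
  have hS2 : ∑ b ∈ Finset.univ.filter (fun b : ZMod ℓ ↦ χ b = ε), g ((q : ZMod ℓ)⁻¹ * b) =
      ∑ b ∈ Finset.univ.filter (fun b : ZMod ℓ ↦ χ b = χ q * ε), g b := by
    refine Finset.sum_nbij' (fun b ↦ (q : ZMod ℓ)⁻¹ * b) (fun b ↦ (q : ZMod ℓ) * b) ?_ ?_ ?_ ?_ ?_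
    · intro b hb
      simp only [Finset.mem_filter, Finset.mem_univ, true_and] at hb ⊢
      rw [map_mul, hχinv, hb, hδ]
    · intro b hb
      simp only [Finset.mem_filter, Finset.mem_univ, true_and] at hb ⊢
      rw [map_mul, hb, ← hδ, ← mul_assoc, hδsq, one_mul]
    · intro b _; simp only [mul_inv_cancel_left₀ hqu]
    · intro b _; simp only [inv_mul_cancel_left₀ hqu]
    · intro b _; rfl
  refine ⟨i, ?_⟩
  rw [Finset.mul_sum, hi, Finset.sum_add_distrib, ← Finset.mul_sum, hS1, hS2]
  ring

/-- **THE HALF-CHARACTER SUMS ARE `2`-ADICALLY HALF-INTEGRAL.** For a rational newform `f` (real coefficients) of level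
`N` with `ℓ² ∣ N`, `a_ℓ(f) = 0`, a character `χ` mod `ℓ` with values in `ℤ`, and ONE odd prime `q ∤ N` with `a_q − q − 1` ODD
(available when `E[2]` is irreducible), each of the sums `Σ_{χ(b)=ε} [b/ℓ]⁺_f` (`ε = ±1`) equals `j/(2n₁)` with `n₁` ODD:
if `χ(q) = 1`, `(a_q − q − 1)·H^ε ∈ ½ℤ` (`exists_intCast_mul_sum_filter_eq`); if `χ(q) = −1`,
`(a_q + q + 1)·H^ε = −(q+1)·[0]⁺ + j/2` with `[0]⁺ = k₀/(2(a_q − q − 1))` (`exists_ratPlusSymbol_eq_div_two`, the odd Eisenstein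
multiple `(a_q − q − 1){∞,0} ∈ Λ_f`, `sub_mul_modularSymbol_zero_mem_periodLattice`). The both-additive substitute for the
class-`1/g` Manin trick of `…TameIntegralityAtTwoSharedPrimesProofs`. [cite: MazurTateTeitelbaum1986Invent, §I.4 (4.2) and §I.8]
[cite: CremonaAlgorithms1997, §2.8 (2.8.8)] [cite: GreenbergVatsal2000, Prop. (3.7)] -/
theorem exists_sum_filter_ratPlusSymbol_div_eq_div_two_mul (hf : IsNewform0 f) (hreal : ∀ n, (cuspCoeff f n).im = 0)
    (hrat : ∀ r : ℚ, (ratPlusSymbol f r : ℝ) = normalizedPlusSymbol f r)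
    (hℓN : ℓ ^ 2 ∣ N) (haℓ : cuspCoeff f ℓ = 0) {q : ℕ} [Fact q.Prime] (hqN : ¬ q ∣ N) {aq : ℤ}
    (haq : cuspCoeff f q = aq) (hodd : ¬ (2 : ℤ) ∣ aq - q - 1) (χ : MulChar (ZMod ℓ) ℤ) {ε : ℤ}
    (hε : ε = 1 ∨ ε = -1) :
    ∃ n₁ j : ℤ, ¬ (2 : ℤ) ∣ n₁ ∧
      ∑ b ∈ Finset.univ.filter (fun b : ZMod ℓ ↦ χ b = ε), ratPlusSymbol f ((b.val : ℚ) / ℓ) =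
        (j : ℚ) / (2 * n₁) := by
  have hq : q.Prime := Fact.out
  have hℓ : ℓ.Prime := Fact.out
  have hℓN' : ℓ ∣ N := (dvd_pow_self ℓ two_ne_zero).trans hℓN
  have hqℓ : ¬ q ∣ ℓ := fun h ↦ hqN (h.trans hℓN')
  have hqu : (q : ZMod ℓ) ≠ 0 := by
    rw [Ne, ZMod.natCast_eq_zero_iff]
    intro h
    exact hqℓ (by rw [(Nat.prime_dvd_prime_iff_eq hℓ hq).mp h])
  set H : ℤ → ℚ := fun e ↦ ∑ b ∈ Finset.univ.filter (fun b : ZMod ℓ ↦ χ b = e),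
    ratPlusSymbol f ((b.val : ℚ) / ℓ) with hH
  have hn₀ : aq - q - 1 ≠ 0 := by rintro h; rw [h] at hodd; exact hodd (dvd_zero 2)
  obtain ⟨j₁, hj₁⟩ := exists_intCast_mul_sum_filter_eq f hf hreal hrat hℓN hqN haq χ ε
  rcases mulChar_apply_eq_one_or_eq_neg_one χ hqu with hδ | hδ
  · -- `χ(q) = 1`: `(a_q − q − 1) H^ε = j/2`
    rw [hδ, one_mul] at hj₁
    refine ⟨aq - q - 1, j₁, hodd, ?_⟩
    change H ε = _
    have h : ((aq : ℚ) - q - 1) * H ε = (j₁ : ℚ) / 2 := by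
      change (aq : ℚ) * H ε = ((q : ℚ) + 1) * H ε + (j₁ : ℚ) / 2 at hj₁
      linear_combination hj₁
    have hn₀Q : ((aq : ℚ) - q - 1) ≠ 0 := by exact_mod_cast hn₀
    field_simp at h
    push_cast
    field_simp
    linear_combination h
  · -- `χ(q) = −1`: use `H^ε + H^{−ε} = −[0]⁺ = −k₀/(2n₀)`
    rw [hδ, neg_one_mul] at hj₁
    have h0mem : ((aq - q - 1 : ℤ) : ℂ) * modularSymbol f 0 ∈ periodLattice f := by
      have h := sub_mul_modularSymbol_zero_mem_periodLattice hf hq hqN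
      rw [haq] at h
      push_cast at h ⊢
      exact h
    obtain ⟨k₀, hk₀⟩ := exists_ratPlusSymbol_eq_div_two f hreal hn₀ h0mem (x := 0)
      (by rw [Rat.den_zero]; exact Nat.coprime_one_left N)
    have hpair := sum_filter_one_add_sum_filter_neg_one_eq f hf hrat hℓN' haℓ χ
    -- `H^ε + H^{−ε} = −[0]⁺` in either case
    have hcomp : H ε + H (-ε) = -ratPlusSymbol f 0 := by
      rcases hε with h | h
      · rw [h]; exact hpair
      · rw [h, neg_neg, add_comm]; exact hpair
    refine ⟨(aq - q - 1) * (aq + q + 1), -(q + 1) * k₀ + j₁ * (aq - q - 1), ?_, ?_⟩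
    · intro h
      rcases (Int.prime_two.dvd_or_dvd h) with h1 | h1
      · exact hodd h1
      · have e : aq - q - 1 = (aq + q + 1) - 2 * (q + 1) := by ring
        exact hodd (by rw [e]; exact dvd_sub h1 (dvd_mul_right 2 (q + 1 : ℤ)))
    change H ε = _
    change (aq : ℚ) * H ε = ((q : ℚ) + 1) * H (-ε) + (j₁ : ℚ) / 2 at hj₁
    have hHneg : H (-ε) = -ratPlusSymbol f 0 - H ε := by linear_combination hcomp
    rw [hHneg, hk₀] at hj₁
    have hn₀Q : ((aq : ℚ) - q - 1) ≠ 0 := by exact_mod_cast hn₀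
    have hn₂Q : ((aq : ℚ) + q + 1) ≠ 0 := by
      have h2 : ¬ (2 : ℤ) ∣ aq + q + 1 := fun h1 ↦ by
        have e : aq - q - 1 = (aq + q + 1) - 2 * (q + 1) := by ring
        exact hodd (by rw [e]; exact dvd_sub h1 (dvd_mul_right 2 (q + 1 : ℤ)))
      have : aq + q + 1 ≠ 0 := by rintro h; rw [h] at h2; exact h2 (dvd_zero 2)
      exact_mod_cast this
    push_cast at hj₁ ⊢
    field_simp at hj₁
    field_simp
    linear_combination hj₁

/-- **`‖Σ_{χ(b)=ε} [b/ℓ]⁺‖₂ ≤ 2`** under the hypotheses of `exists_sum_filter_ratPlusSymbol_div_eq_div_two_mul` (`‖j/(2n₁)‖₂ ≤ 2` for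
`n₁` odd). [cite: MazurTateTeitelbaum1986Invent, §I.8 and §I.10] -/
theorem norm_ratCast_le_two_of_eq_div_two_mul {x : ℚ} {n₁ j : ℤ} (hn₁ : ¬ (2 : ℤ) ∣ n₁) (hx : x = (j : ℚ) / (2 * n₁)) :
    ‖((x : ℚ) : ℚ_[2])‖ ≤ 2 := by
  have hn : ‖((n₁ : ℤ) : ℚ_[2])‖ = 1 :=
    le_antisymm (Padic.norm_int_le_one _)
      (not_lt.mp fun hlt ↦ hn₁ (by exact_mod_cast Padic.norm_intCast_lt_one_iff.mp hlt))
  have h2 : ‖(2 : ℚ_[2])‖ = (2 : ℝ)⁻¹ := by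
    have h := Padic.norm_p (p := 2)
    simpa using h
  rw [hx]
  push_cast
  rw [norm_div, norm_mul, h2, hn, mul_one]
  have hk1 : ‖((j : ℤ) : ℚ_[2])‖ ≤ 1 := Padic.norm_int_le_one j
  calc ‖((j : ℤ) : ℚ_[2])‖ / (2 : ℝ)⁻¹ = 2 * ‖((j : ℤ) : ℚ_[2])‖ := by
        rw [div_eq_mul_inv, inv_inv, mul_comm]
    _ ≤ 2 * 1 := by gcongr
    _ = 2 := mul_one _

end HalfSums




end Summit.BirchSwinnertonDyer.BirchSwinnertonDyer.Theorems.AlignedTransportAtTwoAddTwistHalfSums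

end
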